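/-
Copyright: statement-level skeleton of a published paper (lit-balaban cell, Phase-2 proof seat p25, gen 18). No proof
claims beyond what the kernel checks below.
-/
import Literature.MathematicalPhysics.QuantumFieldTheory.BalabanImbrieJaffe1984to88.BIJ88WalkLocalTermCount312
import Literature.MathematicalPhysics.QuantumFieldTheory.BalabanImbrieJaffe1984to88.BIJ88WalkLabelPartition312

/-!
# `BalabanImbrieJaffe1984to88.BIJ88WalkTermNorm312` — T. Bałaban, J. Imbrie, A. Jaffe, *Effective action and cluster
properties of the abelian Higgs model*, Commun. Math. Phys. **114** (1988) 257–315 [BalabanImbrieJaffe1988], §5.14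
p. 312 [PDF 56], verbatim: *"The main source of concern in estimating G_k(X_{r′}) is that we only have bounds
|F_{k,loc}(X_{σ₁})| ≤ c(L^kε)^{−m(c)}e^{−m′(c)} coming from our estimates on perturbation expansions of observables
similarly for F_{k+1,loc}(X_c)."*, *"By performing sufficiently many integrations by parts, we have arranged for enough
small factors to beat these large factors in the remainder terms (at least if X_{r′} is not at the boundary of
Λ^{(k)})."*, and the estimate *"|G_k(X)| ≤ c(F(X))(e^β(L^kε/ε₀)^{1/4−α})^{β′|X∖∪X_c|} Π [c(L^kε)^{−m(c)}e^{−m′(c)}]"* (DOCFIX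
p25 gen 19, ref-5 D-g64-2 / ref-1 g77: the gen-18 header paraphrased the second sentence inside quotation marks; the
printed sentence is restored, declarations untouched) — **ALL THE TERMS OF THE EXPANSION OF `⟨Π_j F_j⟩`, SIZED IN
UNITS OF ONE SMALL FACTOR
PER UNCOVERED CUBE, SUM TO A LARGE CONSTANT PER OBSERVABLE TIMES `c(F)`** (p25 gen 18): combining the ℓ¹ norm in
units of the printed shape (`BIJ88WalkLocalTermCount312.expand_l1_shape_le`) with the partition of the observables
among the components (`BIJ88WalkLabelPartition312.prod_labels_eq`):
`Σ_{t ∈ expand 0 K} |coef_t|·Π‖dirs_t‖ · θ^{−Σ_{X ∈ t} #(cubes X ∖ obs cubes of X)} ≤ W^{Φ₀(K)} · Π_{j∈K} B_ℓ^{|obs j|}`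
— the three factors of the printed estimate (small factor per uncovered cube, large constant per observable,
combinatorial `c(F)`), for the constant AND the remainder components together, uniformly in the volume; the Gaussian
integral carried by the remainder components is the part not sized here.

statement-level skeleton of published theorems with citation tags; proofs where landed; nothing here is a claim
about the Yang–Mills mass gap

PDF held: `paper:balaban1988-cmp114-bij-abelian-higgs-effective-action` (journal page = PDF page + 256); p. 312 =
PDF 56 (`p0056.txt` L1–25 re-read 2026-08-22; L20–28 re-read for the docfix, 2026-08-23).

CITATION HEADER (lean-in-tree rule).  lit-balaban cell (HOME `run/shared/lean/pub/lit-balaban/`), Phase 2, seat p25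
gen 18; row **C2.Claim@312** of `HOME/lit-balaban-r16/ROWS-C2-part2.md` (owner r16, referee ref-5; head
`BIJ88Sect5StatementsPart4.Ineq312` untouched — MEMBER of the row).  USED BY NAME, nothing restated:
`BIJ88WalkLocalTermCount312.expand_l1_shape_le`, `BIJ88WalkLabelPartition312.prod_labels_eq`,
`BIJ88WalkActivityShape312.shape`, `BIJ88WalkGeometry311.cubes`, `BIJ88WalkExpansion311.expand` (this seat and
generation), `BIJ88VertexComponents311.maxArity`.

## What is proved (0 `sorry`, standard axioms, no new `Prop` facts; theorems only)

* `prod_shape_eq` (`Π_X shape X = (Π_{j∈K} B_ℓ^{|obs j|})·θ^{Σ_X #free(X)}` for the terms of `expand 0 K`),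
  **`expand_l1_free_le`**.
HONEST SCOPE: as `BIJ88WalkLocalTermCount312` — locality/convergence and `B = B′·ρ` hypothesised; the remainder
components' Gaussian integral not estimated; constant `W^{Φ₀(K)}`; contraction-graph components; no `Ineq312` binder.
NOT summit progress; NOT continuum; NOT Clay.  Imports `BIJ88WalkLocalTermCount312`, `BIJ88WalkLabelPartition312`;
modifies nothing.
-/

noncomputable section

namespace Literature.MathematicalPhysics.QuantumFieldTheory.BalabanImbrieJaffe1984to88.BIJ88WalkTermNorm312

open Classical Matrix Finset
open scoped BigOperators
open BIJ88VertexComponents311 (maxArity)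
open BIJ88WalkRun311 BIJ88WalkGeometry311 BIJ88WalkExpansion311 BIJ88WalkActivityShape312 BIJ88WalkLocalTermCount312
  BIJ88WalkLabelPartition312

variable {S : Type} [Fintype S] {ι : Type} [Fintype ι] {κ : Type} [LinearOrder κ] {P : Type} [Fintype P]
  {β : Type} [DecidableEq β]

variable {Cov : P → Matrix S S ℝ} {trig : P → Bool} {f : S → ℝ} {c : ι → ℝ} {legs : ι → List (S → ℝ)}
  {obs : κ → List (S → ℝ)} {M : ℕ} {oc : κ → Finset β} {vc : ι → Finset β} {reg : P → Finset β}

omit [Fintype S] [Fintype ι] [LinearOrder κ] [Fintype P] in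
/-- `Π_{a ∈ m} θ^{n a} = θ^{Σ_{a ∈ m} n a}` (bookkeeping). [folklore] -/
private theorem prod_map_pow_eq (θ : ℝ) (n : WGrp S κ ι P → ℕ) (m : Multiset (WGrp S κ ι P)) :
    (m.map fun X => θ ^ n X).prod = θ ^ (m.map n).sum := by
  induction m using Multiset.induction_on with
  | empty => simp
  | cons a m ih => rw [Multiset.map_cons, Multiset.prod_cons, Multiset.map_cons, Multiset.sum_cons, pow_add, ih]

/-- **The printed shape of a whole term**: `Π_{X ∈ t.consts + t.groups} shape X = (Π_{j∈K} B_ℓ^{|obs j|}) · θ^{Σ_X #(cubes X ∖ ⋃_{j∈X.lab} oc j)}`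
for every term of `expand 0 K` (the observables are partitioned among the components).
[cite: BalabanImbrieJaffe1988, §5.14 p.312] -/
theorem prod_shape_eq (Bl θ : ℝ) (K : Finset κ) :
    ∀ t ∈ expand Cov trig f c legs obs M 0 K,
      ((t.consts + t.groups).map (shape obs oc vc reg Bl θ)).prod
        = (∏ j ∈ K, Bl ^ (obs j).length)
          * θ ^ ((t.consts + t.groups).map fun X => (cubes oc vc reg X \ X.lab.biUnion oc).card).sum := by
  intro t ht
  have e : ((t.consts + t.groups).map (shape obs oc vc reg Bl θ))
      = (t.consts + t.groups).map fun X => (∏ j ∈ X.lab, Bl ^ (obs j).length)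
          * θ ^ (cubes oc vc reg X \ X.lab.biUnion oc).card := Multiset.map_congr rfl fun X _ => rfl
  rw [e, Multiset.prod_map_mul, prod_labels_eq (Cov := Cov) (trig := trig) (f := f) (c := c) (legs := legs) (M := M)
    (fun j => Bl ^ (obs j).length) K t ht, prod_map_pow_eq]

/-- **ALL TERMS, SIZED IN UNITS OF ONE SMALL FACTOR PER UNCOVERED CUBE**: under the hypotheses of
`BIJ88WalkLocalTermCount312.expand_l1_shape_le`,
`Σ_{t ∈ expand 0 K} |coef_t|·Π_{z∈dirs_t}‖z‖ · (θ^{Σ_{X} #(cubes X ∖ obs cubes of X)})⁻¹ ≤ W^{Φ₀(K)} · Π_{j∈K} B_ℓ^{|obs j|}`.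
[cite: BalabanImbrieJaffe1988, §5.14 p.312] -/
theorem expand_l1_free_le {Dir : Set (S → ℝ)} {B' ρ : P → ℝ} {cV : ι → ℝ} {Bl θ ρ₀ W : ℝ} {N₀ : ℕ}
    (hθ0 : 0 < θ) (hθ1 : θ ≤ 1) (hBl : 1 ≤ Bl) (hB0 : ∀ p, 0 ≤ B' p) (hρ : ∀ p, 0 ≤ ρ p) (hcV0 : ∀ m, 0 ≤ cV m)
    (hB : ∀ p, ∀ u ∈ Dir, ∀ w ∈ Dir, |(Cov p *ᵥ u) ⬝ᵥ w| ≤ B' p * ρ p)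
    (hBf : ∀ p, ∀ u ∈ Dir, |(Cov p *ᵥ u) ⬝ᵥ f| ≤ B' p * ρ p) (hBz : ∀ p, ∀ u ∈ Dir, ‖Cov p *ᵥ u‖ ≤ B' p * ρ p)
    (hcV : ∀ m, |c m| ≤ cV m) (hobs : ∀ j, ∀ w ∈ obs j, w ∈ Dir) (hlegs : ∀ m, ∀ w ∈ legs m, w ∈ Dir)
    (hloc : ∀ p, trig p = false → B' p ≤ Bl ∧ reg p = ∅) (hwalk : ∀ p, trig p = true → B' p ≤ θ ^ (reg p).card)
    (hvert : ∀ m, cV m * Bl ^ (legs m).length ≤ θ ^ (vc m).card) (hρ₀0 : 0 ≤ ρ₀)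
    (hρ₀ : ∀ u ∈ Dir, (∑ p ∈ univ.filter (fun p => Cov p *ᵥ u ≠ 0), ρ p) ≤ ρ₀)
    (hN : ∀ p, ∀ u ∈ Dir,
      (∑ m, ((range (legs m).length).filter fun j => (Cov p *ᵥ u) ⬝ᵥ (legs m).getD j 0 ≠ 0).card) ≤ N₀)
    (K : Finset κ) (hW1 : 1 ≤ W)
    (hW : ρ₀ * ((∑ j ∈ K, ((obs j).length + 1 + M * maxArity legs) + N₀ : ℕ) : ℝ) ≤ W) :
    ((expand Cov trig f c legs obs M 0 K).map fun t =>
        |t.coef| * (t.dirs.map fun z => ‖z‖).prod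
          * (θ ^ ((t.consts + t.groups).map fun X => (cubes oc vc reg X \ X.lab.biUnion oc).card).sum)⁻¹).sum
      ≤ W ^ (∑ j ∈ K, ((obs j).length + 1 + M * maxArity legs)) * ∏ j ∈ K, Bl ^ (obs j).length := by
  have hC : 0 < ∏ j ∈ K, Bl ^ (obs j).length := prod_pos fun j _ => pow_pos (zero_lt_one.trans_le hBl) _
  have h := expand_l1_shape_le (oc := oc) (vc := vc) (reg := reg) hθ0 hθ1 hBl hB0 hρ hcV0 hB hBf hBz hcV hobs hlegs hloc
    hwalk hvert hρ₀0 hρ₀ hN K hW1 hW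
  -- each summand is `(Π_j B_ℓ^{|obs j|}) ·` the summand of `expand_l1_shape_le`
  have e : ((expand Cov trig f c legs obs M 0 K).map fun t =>
        |t.coef| * (t.dirs.map fun z => ‖z‖).prod
          * (θ ^ ((t.consts + t.groups).map fun X => (cubes oc vc reg X \ X.lab.biUnion oc).card).sum)⁻¹)
      = (expand Cov trig f c legs obs M 0 K).map fun t => (∏ j ∈ K, Bl ^ (obs j).length)
          * (|t.coef| * (t.dirs.map fun z => ‖z‖).prod / ((t.consts + t.groups).map (shape obs oc vc reg Bl θ)).prod) := by
    refine Multiset.map_congr rfl fun t ht => ?_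
    rw [prod_shape_eq (Cov := Cov) (trig := trig) (f := f) (c := c) (legs := legs) (M := M) Bl θ K t ht]
    field_simp
  rw [e, Multiset.sum_map_mul_left, mul_comm]
  exact mul_le_mul_of_nonneg_right h hC.le

end Literature.MathematicalPhysics.QuantumFieldTheory.BalabanImbrieJaffe1984to88.BIJ88WalkTermNorm312

end
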